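import Literature.Probability.RandomPlanarGeometry.SAWLadderGoldenMean
import Mathlib.RingTheory.PowerSeries.Inverse
import Mathlib.Analysis.SpecificLimits.Normed
import Mathlib.NumberTheory.Real.GoldenRatio
import Mathlib.Tactic
import HarnessLib

/-!
# Zeilberger's exact count of the self-avoiding walks of the ladder `ℤ × {0,1}`:
# `a_n = 8F_n − (n/2)(1 + (−1)^n) − 2(1 − (−1)^n)` (`n > 1`), gf `(1 + 2t − t³ − t⁴ + t⁷)/((1−t)²(1+t)²(1−t−t²))`

Topic `Literature/Probability/RandomPlanarGeometry` (continues `SAWLadderGoldenMean.lean`: the ladder `𝕃 = ℤ × {0,1}`, its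
walks from a vertex `Ladder.ladderWalks y₀ N` (`σ_N` of Grimmett–Li), `μ(𝕃) = φ`; and `SAWWords.lean`: step words
`List Step`, `traj`, `IsSAW`, `words`, `wordOf`, `traj_wordOf`, `eq_of_traj_eq`).

THE PRINTED STATEMENT.  D. Zeilberger, *Self-avoiding walks, the language of science, and Fibonacci numbers*, J. Statist.
Plann. Inference 54 (1996) 135–138 = arXiv:math/9506214 (held: `paper:arxiv-math_9506214`, p. 1): "Theorem: The number,
`a_n^{(2)}`, of `n`-step saws in the strip `{0,1} × [−∞, ∞]` is given by `a_0^{(2)} = 1`, `a_1^{(2)} = 3`, and for `n > 1`, by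
`a_n^{(2)} = 8F_n − (n/2)(1 + (−1)^n) − 2(1 − (−1)^n)`."  The proof there (p. 1–2) factors every saw as `U L* I U'` and obtains
the generating function "`(1 + 2t − t³ − t⁴ + t⁷)/((1 − t)²(1 + t)²(1 − t − t²))`" (p. 2), then partial fractions.  Zeilberger's strip
`{0,1} × ℤ` is the tree's ladder `ℤ × {0,1}` with the coordinates exchanged, and `a_n^{(2)} = #Ladder.ladderWalks 0 n` (walks
from the vertex `(0,0)`; by `Ladder.card_ladderWalks_one` the other row gives the same count).

THIS FILE proves the theorem for the tree's object:

  ★★★ `card_ladderWalks_series : (Σ_N #ladderWalks 0 N · X^N) · (1 − X)²(1 + X)²(1 − X − X²) = 1 + 2X − X³ − X⁴ + X⁷`,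
  ★★★ `card_ladderWalks_eq_fib : 2 ≤ n → #ladderWalks 0 n = zeil n`, `zeil n = 8·fib n − (if n even then n else 4)`
      (= the printed `8F_n − (n/2)(1 + (−1)^n) − 2(1 − (−1)^n)`), `card_ladderWalks_values` (`1, 3, 6, 12, 20, 36, 58, 100`),
  `card_ladderWalks_rec` (the order-6 linear recurrence).

SECOND PRINTED SOURCE: C. Lindorfer, *The Language of Self-Avoiding Walks* (2018), §6.2, eq. (6.14): the same generating
function `F_W(t) = (1 + 2t − t³ − t⁴ + t⁷)/((1 − t)²(1 + t)²(1 − t − t²))`, derived from the regular language of the SAWs of `𝕃`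
(a transfer-matrix/automaton derivation in print).  METHOD here (a transfer-matrix proof, cf. Lindorfer §6.2; not Zeilberger's
`U L* I U'` factorisation): the lane's counting-automaton-with-counters method of
`HexSAWBrickWallStripWidthOneSeries.lean`, here simpler since the square ladder has a rung at EVERY column):
§1 the counting automaton (`LState`: `start`, `ini k`, `rg1 a`, `ut i`, `fwd k`, `rg2 k`, `cor j`; `stepSum`, `W`, `zCount N =
W start N`); §2 the closed forms `pol s · D⁻¹`, `D = (1 − X)²(1 + X)²(1 − X − X²)` (Zeilberger's denominator); §3 the one-step
identities (`linear_combination huD`); §4 `coeff_Ψ_eq_W`; §5 ★★ `zCount_series`, `zCount_rec`; §6 words from the origin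
(`VisAt`, `Good` = self-avoiding and in the strip, `good_snoc_iff`, `mem_ladderWalks_iff_good`); §7 the geometric automaton
`δ`/`run` on `Step = Fin 4` with heading and row, `card_acc` (accepted words are counted by `W`); §8 the phase invariants `InvS`
and, for every state, `step_<s>` (a successful transition lands on a fresh site inside the strip and re-establishes the invariant)
and `block_<s>` (a good letter is never rejected); §9 ★★ `good_iff_run`, `good_iff_isSome` (THE AUTOMATON ACCEPTS EXACTLY THE
SELF-AVOIDING WALKS OF THE LADDER FROM A VERTEX), `ladderWalks_eq_image`, ★★★ `card_ladderWalks_eq_zCount`; §10 the printed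
theorem: the series, the recurrence, `zeil`, `zeil_rec`, `zCount_eq_zeil_small`, ★★★ `card_ladderWalks_eq_fib`; §11 the
Madras–Slade tube count `Zd.tubeCount 2 1 1 N = c_N(R[1,1]) = 2·zCount N` (`tubeCount_ladder_eq`, `tubeCount_ladder_series`,
`tubeCount_ladder_eq_fib`); §12–§13 (ed.4) THE AMPLITUDE: Binet `F_n/φⁿ → 1/√5`, the correction `([n even]·n + [n odd]·4)/φⁿ → 0`, hence
★ `tendsto_card_ladderWalks_div_pow : a_n/φⁿ → 8/√5` (`a_n ∼ (8/√5)·φⁿ`: amplitude `A = 8/√5`, `γ = 1`, `μ = φ` in Madras–Slade's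
`c_n ∼ Aμⁿn^{γ−1}`) and `tendsto_tubeCount_ladder_div_pow : c_n(R[1,1])/φⁿ → 16/√5`.
Method sources: Lindorfer 2018 §6.2 (regular language of ladder SAWs); R. P. Stanley, *Enumerative Combinatorics* vol. 1, §4.7 (transfer-matrix method, Theorem 4.7.2), §4.1
(Theorem 4.1.1); G. R. Grimmett, Z. Li, Combinatorica 35 (2015) §1 (the ladder, `σ_N`); N. Madras, G. Slade (1993) §1.1.

All statements: namespace `Literature.Probability.RandomPlanarGeometry.SAW.LadderZ`, PROVED, standard axioms.
NOT here: Zeilberger's wider strips `[−r, r] × ℤ`; the `(−1)^n` form is recorded in the docstring of `zeil` (equal to the `if`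
form for every `n`).
-/

noncomputable section

open Finset PowerSeries Literature.Probability.LatticeModels SimpleGraph

namespace Literature.Probability.RandomPlanarGeometry.SAW

namespace LadderZ

/-! ## §1 The counting automaton of the ladder -/

/-- The states of the counting automaton of self-avoiding walks on the square ladder `ℤ × {0,1}` (a rung at every column),
read along a walk prefix started at the origin: `start`; `ini k` (initial horizontal run of length `k+1`, no rung yet); `rg1 a`
(just after the FIRST rung, initial run of length `a`); `ut i` (walking back over the initial run after a reversal at the first
rung, `i` of its sites still ahead); `fwd k` (`k+1` horizontal steps since the last rung — or, after a U-turn, `k+1` columns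
beyond the start); `rg2 k` (just after a later rung whose approach run had length `k+1`); `cor j` (dead-end corridor, `j` free
sites ahead).  [cite: Zeilberger1996, Theorem (proof: the factorisation U L* I U')] -/
inductive LState
  | start
  | ini (k : ℕ)
  | rg1 (a : ℕ)
  | ut (i : ℕ)
  | fwd (k : ℕ)
  | rg2 (k : ℕ)
  | cor (j : ℕ)
  deriving DecidableEq, Repr

open LState

/-- **One step of the automaton, as a sum over the successor states** (a rung is available at every column, never twice in a
row). [cite: Stanley2012EC1, §4.7 (transfer-matrix method, Theorem 4.7.2)] -/
def stepSum {α : Type*} [AddCommMonoid α] (f : LState → α) : LState → α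
  | start => 2 • f (ini 0) + f (rg1 0)
  | ini k => f (ini (k + 1)) + f (rg1 (k + 1))
  | rg1 0 => 2 • f (fwd 0)
  | rg1 (j + 1) => f (fwd 0) + f (ut j)
  | ut 0 => f (fwd 0)
  | ut (i + 1) => f (ut i)
  | fwd k => f (fwd (k + 1)) + f (rg2 k)
  | rg2 0 => f (fwd 0)
  | rg2 (j + 1) => f (fwd 0) + f (cor j)
  | cor 0 => 0
  | cor (j + 1) => f (cor j)

/-- **The number `W s m` of accepted continuations of length `m` from state `s`.** [cite: Stanley2012EC1, §4.7] -/
def W : LState → ℕ → ℕ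
  | _, 0 => 1
  | start, m + 1 => 2 * W (ini 0) m + W (rg1 0) m
  | ini k, m + 1 => W (ini (k + 1)) m + W (rg1 (k + 1)) m
  | rg1 0, m + 1 => 2 * W (fwd 0) m
  | rg1 (j + 1), m + 1 => W (fwd 0) m + W (ut j) m
  | ut 0, m + 1 => W (fwd 0) m
  | ut (i + 1), m + 1 => W (ut i) m
  | fwd k, m + 1 => W (fwd (k + 1)) m + W (rg2 k) m
  | rg2 0, m + 1 => W (fwd 0) m
  | rg2 (j + 1), m + 1 => W (fwd 0) m + W (cor j) m
  | cor 0, _ + 1 => 0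
  | cor (j + 1), m + 1 => W (cor j) m

/-- `W s 0 = 1`. [cite: Stanley2012EC1, §4.7] -/
@[simp] theorem W_zero (s : LState) : W s 0 = 1 := by
  cases s <;> rfl

/-- The recursion of `W` is `stepSum`. [cite: Stanley2012EC1, §4.7] -/
theorem W_succ (s : LState) (m : ℕ) : W s (m + 1) = stepSum (fun t => W t m) s := by
  rcases s with _ | k | (_ | j) | (_ | i) | k | (_ | j) | (_ | j) <;> simp [W, stepSum]

/-- `stepSum` commutes with additive maps. [cite: Stanley2012EC1, §4.7] -/
theorem map_stepSum {α β : Type*} [AddCommMonoid α] [AddCommMonoid β] (φ : α →+ β) (f : LState → α) (s : LState) :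
    φ (stepSum f s) = stepSum (fun t => φ (f t)) s := by
  rcases s with _ | k | (_ | j) | (_ | i) | k | (_ | j) | (_ | j) <;> simp [stepSum]

/-- The automaton's count of `N`-step self-avoiding walks of the ladder from a vertex: `zCount N = W start N`
(`= 1, 3, 6, 12, 20, 36, 58, 100, …`). [cite: Zeilberger1996, Theorem] -/
def zCount (N : ℕ) : ℕ := W start N

/-- Sanity values: `zCount N = 1, 3, 6, 12, 20, 36, 58, 100` for `N ≤ 7`. [cite: Zeilberger1996, Theorem] -/
example : (List.range 8).map zCount = [1, 3, 6, 12, 20, 36, 58, 100] := by decide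

/-! ## §2 The closed forms: every state series is `pol s · D⁻¹`, `D = (1 − X)²(1 + X)²(1 − X − X²)` -/

/-- The printed denominator `D = (1 − X)²(1 + X)²(1 − X − X²)`. [cite: Zeilberger1996, Theorem (the gf)] -/
def D : ℤ⟦X⟧ := (1 - X) ^ 2 * (1 + X) ^ 2 * (1 - X - X ^ 2)

/-- `D` has constant coefficient `1`. [cite: Zeilberger1996, Theorem] -/
theorem constantCoeff_D : constantCoeff D = 1 := by
  simp [D]

/-- `D⁻¹` in `ℤ⟦X⟧`. [cite: Zeilberger1996, Theorem] -/
def uD : ℤ⟦X⟧ := PowerSeries.invOfUnit D 1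

/-- `D · D⁻¹ = 1`, expanded. [cite: Zeilberger1996, Theorem] -/
theorem huD : (1 - X) ^ 2 * (1 + X) ^ 2 * (1 - X - X ^ 2) * uD = (1 : ℤ⟦X⟧) := by
  have h := PowerSeries.mul_invOfUnit D 1 (by rw [constantCoeff_D]; rfl)
  simp only [D] at h; exact h

/-- The numerators, by state (found by solving the automaton; verified below):
`start ↦ 1 + 2X − X³ − X⁴ + X⁷`, `ini k ↦ (1 + X − X² − X³ − X⁴ − X⁵) + X^k (X⁴ + X⁵ + X⁶)`,
`rg1 a ↦ (1 + X − 2X² − 3X³ + X⁴ + 2X⁵) + X^a (X² + X³ − X⁵ − X⁶)`, `ut i ↦ (1 − 3X² − X³ + 2X⁴ + X⁵) + X^i (X² + X³ − X⁵ − X⁶)`,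
`fwd k ↦ (1 + X − X² − X³ − X⁴ − X⁵) + X^k (−X² + 2X⁴ + X⁵)`, `rg2 k ↦ (1 + X − 2X² − 3X³ + X⁴ + 2X⁵) + X^k (−X + 3X³ + X⁴ − 2X⁵ − X⁶)`,
`cor j ↦ (1 − 3X² − X³ + 2X⁴ + X⁵) + X^j (−X + 3X³ + X⁴ − 2X⁵ − X⁶)`. [cite: Zeilberger1996, Theorem (proof)] -/
def pol : LState → ℤ⟦X⟧
  | start => 1 + 2 * X - X ^ 3 - X ^ 4 + X ^ 7
  | ini k => (1 + X - X ^ 2 - X ^ 3 - X ^ 4 - X ^ 5) + X ^ k * (X ^ 4 + X ^ 5 + X ^ 6)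
  | rg1 a => (1 + X - 2 * X ^ 2 - 3 * X ^ 3 + X ^ 4 + 2 * X ^ 5) + X ^ a * (X ^ 2 + X ^ 3 - X ^ 5 - X ^ 6)
  | ut i => (1 - 3 * X ^ 2 - X ^ 3 + 2 * X ^ 4 + X ^ 5) + X ^ i * (X ^ 2 + X ^ 3 - X ^ 5 - X ^ 6)
  | fwd k => (1 + X - X ^ 2 - X ^ 3 - X ^ 4 - X ^ 5) + X ^ k * (-X ^ 2 + 2 * X ^ 4 + X ^ 5)
  | rg2 k => (1 + X - 2 * X ^ 2 - 3 * X ^ 3 + X ^ 4 + 2 * X ^ 5) + X ^ k * (-X + 3 * X ^ 3 + X ^ 4 - 2 * X ^ 5 - X ^ 6)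
  | cor j => (1 - 3 * X ^ 2 - X ^ 3 + 2 * X ^ 4 + X ^ 5) + X ^ j * (-X + 3 * X ^ 3 + X ^ 4 - 2 * X ^ 5 - X ^ 6)

/-- The closed form of the state series: `Ψ s = pol s · D⁻¹`. [cite: Zeilberger1996, Theorem] -/
def Ψ (s : LState) : ℤ⟦X⟧ := pol s * uD

/-! ## §3 The one-step identities `Ψ s = 1 + X · stepSum Ψ s` -/

/-- ★ **All one-step identities at once.** [cite: Stanley2012EC1, §4.7 (Theorem 4.7.2)] -/
theorem Ψ_eq_one_add_X_mul_stepSum (s : LState) : Ψ s = 1 + X * stepSum Ψ s := by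
  rcases s with _ | k | (_ | j) | (_ | i) | k | (_ | j) | (_ | j) <;>
    simp only [Ψ, pol, stepSum, nsmul_eq_mul, Nat.cast_ofNat, pow_zero, pow_succ] <;> linear_combination huD

/-! ## §4 The state series are the closed forms -/

/-- `coeff (m+1) (Ψ s) = stepSum (coeff m ∘ Ψ) s`. [cite: Stanley2012EC1, §4.7] -/
theorem coeff_succ_Ψ (s : LState) (m : ℕ) : coeff (m + 1) (Ψ s) = stepSum (fun t => coeff m (Ψ t)) s := by
  rw [Ψ_eq_one_add_X_mul_stepSum s, map_add, coeff_one, if_neg (Nat.succ_ne_zero m), zero_add, coeff_succ_X_mul]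
  exact map_stepSum (coeff m).toAddMonoidHom Ψ s

/-- ★★ **`[X^m] Ψ s = W s m`** for every state and every `m`. [cite: Stanley2012EC1, §4.7 (Theorem 4.7.2)] -/
theorem coeff_Ψ_eq_W (m : ℕ) (s : LState) : coeff m (Ψ s) = (W s m : ℤ) := by
  induction m generalizing s with
  | zero =>
    rw [Ψ_eq_one_add_X_mul_stepSum s, map_add, coeff_zero_one, PowerSeries.coeff_zero_X_mul, add_zero, W_zero,
      Nat.cast_one]
  | succ m ih =>
    rw [coeff_succ_Ψ, W_succ]
    rw [show ((stepSum (fun t => W t m) s : ℕ) : ℤ) = stepSum (fun t => ((W t m : ℕ) : ℤ)) s from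
      map_stepSum (Nat.castAddMonoidHom ℤ) _ s]
    exact congrArg (fun f => stepSum f s) (funext ih)

/-- ★★ **`Σ_m W s m X^m = pol s · D⁻¹`.** [cite: Stanley2012EC1, §4.7 (Theorem 4.7.2)] -/
theorem mk_W_eq_Ψ (s : LState) : PowerSeries.mk (fun m => (W s m : ℤ)) = Ψ s := by
  ext m; rw [coeff_mk, coeff_Ψ_eq_W]

/-! ## §5 The printed generating function and the linear recurrence of `zCount` -/

/-- ★★ **Zeilberger's generating function for the automaton count:**
`(Σ_N zCount N · t^N) · (1 − t)²(1 + t)²(1 − t − t²) = 1 + 2t − t³ − t⁴ + t⁷`. [cite: Zeilberger1996, Theorem (the gf)] -/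
theorem zCount_series :
    PowerSeries.mk (fun N => (zCount N : ℤ)) * ((1 - X) ^ 2 * (1 + X) ^ 2 * (1 - X - X ^ 2)) =
      1 + 2 * X - X ^ 3 - X ^ 4 + X ^ 7 := by
  have hmk : PowerSeries.mk (fun N => (zCount N : ℤ)) = Ψ start := by
    ext N; rw [coeff_mk, coeff_Ψ_eq_W]; rfl
  rw [hmk, Ψ, pol]
  linear_combination (1 + 2 * X - X ^ 3 - X ^ 4 + X ^ 7 : ℤ⟦X⟧) * huD

/-- `[X^{d+k}] (Σ f_N X^N) · X^k = f_d`. [cite: Stanley2012EC1, §4.1] -/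
private theorem coeff_add_mk_mul_X_pow (f : ℕ → ℤ) (d k : ℕ) : coeff (d + k) (PowerSeries.mk f * X ^ k) = f d := by
  rw [PowerSeries.coeff_mul_X_pow, coeff_mk]

/-- ★ **The linear recurrence** (order 6, valid beyond the numerator degree 7):
`c_{n+8} = c_{n+7} + 3c_{n+6} − 2c_{n+5} − 3c_{n+4} + c_{n+3} + c_{n+2}` for `c = zCount`.
[cite: Stanley2012EC1, §4.1 (Theorem 4.1.1)] -/
theorem zCount_rec (n : ℕ) :
    (zCount (n + 8) : ℤ) = zCount (n + 7) + 3 * zCount (n + 6) - 2 * zCount (n + 5) - 3 * zCount (n + 4)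
      + zCount (n + 3) + zCount (n + 2) := by
  set f : ℕ → ℤ := fun N => (zCount N : ℤ) with hf
  have h := congrArg (coeff (n + 8)) zCount_series
  have hQ : ((1 - X) ^ 2 * (1 + X) ^ 2 * (1 - X - X ^ 2) : ℤ⟦X⟧) =
      1 - X - X ^ 2 - X ^ 2 - X ^ 2 + X ^ 3 + X ^ 3 + X ^ 4 + X ^ 4 + X ^ 4 - X ^ 5 - X ^ 6 := by ring
  have hP : coeff (n + 8) (1 + 2 * X - X ^ 3 - X ^ 4 + X ^ 7 : ℤ⟦X⟧) = 0 := by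
    simp only [← map_ofNat PowerSeries.C, map_add, map_sub, PowerSeries.coeff_C_mul, PowerSeries.coeff_X_pow,
      PowerSeries.coeff_X, coeff_one, Nat.reduceEqDiff, if_false, mul_zero, add_zero, sub_zero]
  rw [hQ, hP] at h
  simp only [mul_sub, mul_add, mul_one, map_sub, map_add, coeff_mk] at h
  rw [show (PowerSeries.mk f * X : ℤ⟦X⟧) = PowerSeries.mk f * X ^ 1 by rw [pow_one],
    coeff_add_mk_mul_X_pow f (n + 7) 1, coeff_add_mk_mul_X_pow f (n + 6) 2, coeff_add_mk_mul_X_pow f (n + 5) 3,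
    coeff_add_mk_mul_X_pow f (n + 4) 4, coeff_add_mk_mul_X_pow f (n + 3) 5, coeff_add_mk_mul_X_pow f (n + 2) 6] at h
  simp only [hf] at h
  linear_combination h

/-! ## §6 Words from the origin in the ladder: visited sites, the `Good` predicate, one more letter -/

section words

/-- The site `(cx, cy)` is visited by the word `w` started at the origin (at some time `i ≤ |w|`).
[cite: MadrasSlade1993, §1.1 (walks as step sequences)] -/
def VisAt (w : List Step) (cx cy : ℤ) : Prop := ∃ i ≤ w.length, traj w i 0 = cx ∧ traj w i 1 = cy

/-- **`Good w`**: the word `w` from the origin is a self-avoiding walk of `ℤ²` staying in the strip `0 ≤ y ≤ 1` (the condition of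
`Ladder.ladderWalks 0`). [cite: GrimmettLi2014Bounds, §1 (the ladder 𝕃)] -/
def Good (w : List Step) : Prop := IsSAW w ∧ ∀ i ≤ w.length, 0 ≤ traj w i 1 ∧ traj w i 1 ≤ 1

variable {w : List Step}

/-- The start is visited. [cite: MadrasSlade1993, §1.1] -/
theorem visAt_start : VisAt w 0 0 := ⟨0, Nat.zero_le _, by simp, by simp⟩

/-- The current endpoint is visited. [cite: MadrasSlade1993, §1.1] -/
theorem visAt_end : VisAt w ((wEnd w) 0) ((wEnd w) 1) := ⟨w.length, le_rfl, by rw [traj_length], by rw [traj_length]⟩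

/-- Visited sites after one more letter: the old ones and the new endpoint. [cite: MadrasSlade1993, §1.1] -/
theorem visAt_snoc_iff (ℓ : Step) (cx cy : ℤ) :
    VisAt (w ++ [ℓ]) cx cy ↔ VisAt w cx cy ∨ ((wEnd w) 0 + Step.dx ℓ = cx ∧ (wEnd w) 1 + Step.dy ℓ = cy) := by
  constructor
  · rintro ⟨i, hi, h0, h1⟩
    rw [List.length_append, List.length_singleton] at hi
    rcases Nat.lt_or_ge i (w.length + 1) with hlt | hge
    · left
      refine ⟨i, by omega, ?_, ?_⟩ <;> [rw [← h0]; rw [← h1]] <;> rw [traj_append_left _ _ (by omega)]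
    · right
      have hi' : i = w.length + 1 := by omega
      subst hi'
      rw [traj_append_right w [ℓ] 1, show traj [ℓ] 1 = Step.vec ℓ by simp [traj]] at h0 h1
      simp only [Pi.add_apply, Step.vec_apply_zero, Step.vec_apply_one] at h0 h1
      exact ⟨h0, h1⟩
  · rintro (⟨i, hi, h0, h1⟩ | ⟨h0, h1⟩)
    · exact ⟨i, by rw [List.length_append]; omega, by rw [traj_append_left _ _ hi]; exact h0,
        by rw [traj_append_left _ _ hi]; exact h1⟩
    · refine ⟨w.length + 1, by simp, ?_, ?_⟩ <;>
        rw [traj_append_right w [ℓ] 1, show traj [ℓ] 1 = Step.vec ℓ by simp [traj]] <;>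
        simp [h0, h1]

/-- `Good` for the empty word. [cite: GrimmettLi2014Bounds, §1] -/
theorem good_nil : Good [] := by
  refine ⟨isSAW_nil, fun i hi => ?_⟩
  have : i = 0 := by simpa using hi
  subst this; simp

/-- **One more letter**: `w ++ [ℓ]` is good iff `w` is good, the new site is fresh and it is in the strip.
[cite: MadrasSlade1993, §1.1] -/
theorem good_snoc_iff (ℓ : Step) :
    Good (w ++ [ℓ]) ↔
      Good w ∧ ¬ VisAt w ((wEnd w) 0 + Step.dx ℓ) ((wEnd w) 1 + Step.dy ℓ) ∧
        (0 ≤ (wEnd w) 1 + Step.dy ℓ ∧ (wEnd w) 1 + Step.dy ℓ ≤ 1) := by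
  have hlen : (w ++ [ℓ]).length = w.length + 1 := by simp
  have hlast : traj (w ++ [ℓ]) (w.length + 1) = wEnd w + Step.vec ℓ := by
    rw [traj_append_right w [ℓ] 1, show traj [ℓ] 1 = Step.vec ℓ by simp [traj]]
  have hleft : ∀ i ≤ w.length, traj (w ++ [ℓ]) i = traj w i := fun i hi => traj_append_left _ _ hi
  constructor
  · rintro ⟨hs, hin⟩
    have hs' : IsSAW w := by simpa using hs.take w.length
    refine ⟨⟨hs', fun i hi => ?_⟩, ?_, ?_⟩
    · have := hin i (by rw [hlen]; omega); rwa [hleft i hi] at this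
    · rintro ⟨i, hi, h0, h1⟩
      have hinj := (isSAW_iff_injOn _).1 hs
      have heq : traj (w ++ [ℓ]) i = traj (w ++ [ℓ]) (w.length + 1) := by
        rw [hleft i hi, hlast]
        funext jj; fin_cases jj <;> simp [h0, h1]
      have := hinj (show i ∈ {j | j ≤ (w ++ [ℓ]).length} by simp; omega)
        (show w.length + 1 ∈ {j | j ≤ (w ++ [ℓ]).length} by simp) heq
      omega
    · have := hin (w.length + 1) (by rw [hlen])
      rw [hlast] at this
      simpa using this
  · rintro ⟨⟨hs, hin⟩, hfresh, hstrip⟩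
    refine ⟨?_, fun i hi => ?_⟩
    · rw [isSAW_iff_injOn] at hs ⊢
      intro i hi j hj hij
      simp only [Set.mem_setOf_eq, hlen] at hi hj
      rcases Nat.lt_or_ge i (w.length + 1) with hi' | hi' <;> rcases Nat.lt_or_ge j (w.length + 1) with hj' | hj'
      · rw [hleft i (by omega), hleft j (by omega)] at hij
        exact hs (show i ≤ w.length by omega) (show j ≤ w.length by omega) hij
      · exfalso; apply hfresh
        obtain rfl : j = w.length + 1 := by omega
        rw [hleft i (by omega), hlast] at hij
        refine ⟨i, by omega, ?_, ?_⟩ <;> simp [hij]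
      · exfalso; apply hfresh
        obtain rfl : i = w.length + 1 := by omega
        rw [hleft j (by omega), hlast] at hij
        refine ⟨j, by omega, ?_, ?_⟩ <;> simp [← hij]
      · omega
    · rw [hlen] at hi
      rcases Nat.lt_or_ge i (w.length + 1) with hi' | hi'
      · rw [hleft i (by omega)]; exact hin i (by omega)
      · obtain rfl : i = w.length + 1 := by omega
        rw [hlast]; simpa using hstrip

/-- **The walks of `Ladder.ladderWalks 0` are the good words**: `traj w ∈ ladderWalks 0 |w| ↔ Good w`.
[cite: GrimmettLi2014Bounds, §1 (the ladder 𝕃; σ_N)] -/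
theorem mem_ladderWalks_iff_good : traj w ∈ Ladder.ladderWalks 0 w.length ↔ Good w := by
  classical
  rw [Ladder.ladderWalks, Finset.mem_filter]
  constructor
  · rintro ⟨hω, hin⟩
    refine ⟨?_, fun i hi => by simpa using hin i hi⟩
    rw [isSAW_iff_injOn]; exact (Zd.mem_saws.1 hω).2.2.2
  · rintro ⟨hs, hin⟩
    exact ⟨traj_mem_saws rfl hs, fun i hi => by simpa using hin i hi⟩

end words

/-! ## §7 The geometric automaton on step words (with heading and row) -/

/-- A geometric state: the abstract state, the current heading `h ∈ {+1, −1}` (`0` before the first horizontal step), and the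
current row `r ∈ {0, 1}`. [cite: Stanley2012EC1, §4.7 (transfer-matrix method)] -/
structure GState where
  /-- the abstract state -/
  s : LState
  /-- the heading (`0` = none yet) -/
  h : ℤ
  /-- the current row -/
  r : ℤ
  deriving DecidableEq

/-- Successor under a horizontal step in the current (or a fresh) heading. [cite: Stanley2012EC1, §4.7] -/
def fwdT : LState → Option LState
  | start => some (ini 0)
  | ini k => some (ini (k + 1))
  | rg1 _ => some (fwd 0)
  | ut 0 => some (fwd 0)
  | ut (i + 1) => some (ut i)
  | fwd k => some (fwd (k + 1))
  | rg2 _ => some (fwd 0)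
  | cor 0 => none
  | cor (j + 1) => some (cor j)

/-- Successor under a horizontal step AGAINST the current heading (a reversal). [cite: Stanley2012EC1, §4.7] -/
def backT : LState → Option LState
  | rg1 (j + 1) => some (ut j)
  | rg2 (j + 1) => some (cor j)
  | _ => none

/-- Successor under a rung (available at every column, never twice in a row, never in a U-turn or a corridor).
[cite: Stanley2012EC1, §4.7] -/
def rungT : LState → Option LState
  | start => some (rg1 0)
  | ini k => some (rg1 (k + 1))
  | fwd k => some (rg2 k)
  | _ => none

/-- **The transition function on letters** (`Step = Fin 4`: `0 ↦ +e₀`, `1 ↦ +e₁`, `2 ↦ −e₀`, `3 ↦ −e₁`).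
[cite: Stanley2012EC1, §4.7 (transfer-matrix method)] -/
def δ (g : GState) (ℓ : Step) : Option GState :=
  if Step.dy ℓ = 0 then
    (if g.h ≠ 0 ∧ Step.dx ℓ = -g.h then backT g.s else fwdT g.s).map fun s' => ⟨s', Step.dx ℓ, g.r⟩
  else if Step.dy ℓ = 1 - 2 * g.r then (rungT g.s).map fun s' => ⟨s', g.h, 1 - g.r⟩
  else none

/-- **Running the automaton on a word** (left to right); `none` = rejected. [cite: Stanley2012EC1, §4.7] -/
def run (g : GState) (w : List Step) : Option GState :=
  w.foldl (fun og ℓ => og.bind fun g' => δ g' ℓ) (some g)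

/-- The starting configuration at the origin: no step, no heading, row `0`. [cite: GrimmettLi2014Bounds, §1] -/
def startG : GState := ⟨start, 0, 0⟩

section run

variable (g : GState)

/-- `run` on the empty word. [cite: Stanley2012EC1, §4.7] -/
@[simp] theorem run_nil : run g [] = some g := rfl

/-- Once rejected, always rejected. [folklore] -/
private theorem foldl_none (w : List Step) : w.foldl (fun og ℓ => og.bind fun g' => δ g' ℓ) none = none := by
  induction w with
  | nil => rfl
  | cons ℓ w ih => exact ih

/-- `run` on `ℓ :: w`. [cite: Stanley2012EC1, §4.7] -/
theorem run_cons (ℓ : Step) (w : List Step) : run g (ℓ :: w) = (δ g ℓ).bind fun g' => run g' w := by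
  rw [run, List.foldl_cons, Option.bind]
  cases hδ : δ g ℓ with
  | none => exact foldl_none w
  | some g' => rfl

/-- `run` on `w ++ [ℓ]`. [cite: Stanley2012EC1, §4.7] -/
theorem run_snoc (w : List Step) (ℓ : Step) : run g (w ++ [ℓ]) = (run g w).bind fun g' => δ g' ℓ := by
  rw [run, List.foldl_append, List.foldl_cons, List.foldl_nil]; rfl

end run

/-! ### Counting accepted words -/

/-- Heading bookkeeping: no heading exactly in the states `start` and `rg1 0`, otherwise `h = ±1`. [cite: Stanley2012EC1, §4.7] -/
def HOk (g : GState) : Prop :=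
  match g.s with
  | start => g.h = 0
  | rg1 0 => g.h = 0
  | _ => g.h = 1 ∨ g.h = -1

/-- The accepted words of length `m` from `g`. [cite: Stanley2012EC1, §4.7] -/
def acc (g : GState) (m : ℕ) : Finset (List Step) := (words m).filter fun w => (run g w).isSome

/-- The words of length `m + 1` are the `ℓ :: w`, `w` of length `m`. [cite: MadrasSlade1993, §1.1 (walks as step sequences)] -/
private theorem words_succ (m : ℕ) : words (m + 1) = (Finset.univ ×ˢ words m).image fun q => q.1 :: q.2 := by
  ext w
  simp only [mem_words, Finset.mem_image, Finset.mem_product, Finset.mem_univ, true_and, Prod.exists]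
  constructor
  · intro h
    cases w with
    | nil => simp at h
    | cons ℓ w => exact ⟨ℓ, w, by simpa using h, rfl⟩
  · rintro ⟨ℓ, w', hw', rfl⟩; simpa using hw'

/-- One letter at a time: `#acc (m+1)` is the sum over the first letter. [cite: Stanley2012EC1, §4.7] -/
theorem card_acc_succ (g : GState) (m : ℕ) :
    (acc g (m + 1)).card = ∑ ℓ : Step, ((δ g ℓ).elim 0 fun g' => (acc g' m).card) := by
  classical
  have hinj : Function.Injective (fun q : Step × List Step => q.1 :: q.2) := by
    rintro ⟨a, b⟩ ⟨c, d⟩ h; simpa using h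
  rw [acc, words_succ, Finset.filter_image, Finset.card_image_of_injective _ hinj, Finset.card_filter,
    Finset.sum_product]
  refine Finset.sum_congr rfl fun ℓ _ => ?_
  rw [show (∑ w ∈ words m, if (run g (ℓ :: w)).isSome = true then 1 else 0) =
      ∑ w ∈ words m, if ((δ g ℓ).bind fun g' => run g' w).isSome = true then 1 else 0 from
    Finset.sum_congr rfl fun w _ => by rw [run_cons]]
  cases δ g ℓ with
  | none => simp
  | some g' => rw [Option.elim, acc, Finset.card_filter]; rfl

/-- `Option.elim` through an `if`. [folklore] -/
private theorem elim_ite {α β : Type*} (c : Prop) [Decidable c] (x : α) (b : β) (f : α → β) :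
    (if c then some x else none).elim b f = if c then f x else b := by
  split_ifs <;> rfl

/-- **The accepted words are counted by `W`**: `#acc g m = W g.s m` whenever the heading and row are well formed.
[cite: Stanley2012EC1, §4.7 (transfer-matrix method, Theorem 4.7.2)] -/
theorem card_acc (m : ℕ) (g : GState) (hg : HOk g) (hr : g.r = 0 ∨ g.r = 1) : (acc g m).card = W g.s m := by
  induction m generalizing g with
  | zero =>
    rw [W_zero, acc, Finset.card_eq_one]
    refine ⟨[], ?_⟩
    ext w; simp only [Finset.mem_filter, mem_words, List.length_eq_zero_iff, Finset.mem_singleton]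
    constructor
    · exact fun h => h.1
    · rintro rfl; exact ⟨rfl, by simp⟩
  | succ m ih =>
    rw [card_acc_succ, Fin.sum_univ_four, W_succ]
    obtain ⟨s, h, r⟩ := g
    simp only at hr
    rcases hr with rfl | rfl <;>
    rcases s with _ | k | (_ | j) | (_ | i) | k | (_ | j) | (_ | j) <;>
    simp only [HOk] at hg <;>
    rcases hg with rfl | rfl | rfl <;>
    simp [δ, fwdT, backT, rungT, Step.dx, Step.dy, stepSum, ih, HOk, two_mul] <;> ring

/-! ## §8 The phase invariants (arithmetic form) and the one-letter analysis -/

/-- **The invariant of a state**, on coordinates (start at the origin, `x` = current column, `V` = visited predicate).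
[cite: Stanley2012EC1, §4.7 (transfer-matrix method)] -/
def InvS (x : ℤ) (V : ℤ → ℤ → Prop) : LState → ℤ → ℤ → Prop
  | start, h, r => h = 0 ∧ r = 0 ∧ x = 0 ∧ V 0 0 ∧ ∀ cx cy, V cx cy → cx = 0 ∧ cy = 0
  | ini k, h, r => (h = 1 ∨ h = -1) ∧ r = 0 ∧ x = h * (k + 1) ∧
      (∀ cx cy, V cx cy → cy = 0 ∧ 0 ≤ h * cx ∧ h * cx ≤ k + 1) ∧ ∀ j : ℤ, 0 ≤ j → j ≤ k + 1 → V (h * j) 0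
  | rg1 A, h, r => r = 1 ∧ x = h * A ∧ (A = 0 → h = 0) ∧ (A ≠ 0 → h = 1 ∨ h = -1) ∧
      (∀ cx cy, V cx cy → (cx = x ∧ cy = r) ∨ (cy = 0 ∧ 0 ≤ h * cx ∧ h * cx ≤ A ∧ (A = 0 → cx = 0))) ∧
      ∀ j : ℤ, 0 ≤ j → j ≤ A → V (h * j) 0
  | ut i, h, r => (h = 1 ∨ h = -1) ∧ r = 1 ∧ x = -(h * i) ∧ ∃ A : ℕ, i + 1 ≤ A ∧
      (∀ j : ℤ, 0 ≤ j → j ≤ A → V (-(h * j)) 0) ∧ (∀ j : ℤ, (i : ℤ) ≤ j → j ≤ A → V (-(h * j)) 1) ∧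
      ∀ cx cy, V cx cy → (cy = 0 ∧ 0 ≤ -(h * cx) ∧ -(h * cx) ≤ A) ∨ (cy = 1 ∧ (i : ℤ) ≤ -(h * cx) ∧ -(h * cx) ≤ A)
  | fwd k, h, r => (h = 1 ∨ h = -1) ∧
      (∀ cx cy, V cx cy → (cx = x ∧ cy = r) ∨ h * cx ≤ h * x - 1) ∧
      (∀ cx cy, V cx cy → cy = 1 - r → h * cx ≤ h * (x - h * (k + 1))) ∧
      V (x - h * (k + 1)) (1 - r) ∧ ∀ j : ℤ, 0 ≤ j → j ≤ k + 1 → V (x - h * j) r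
  | rg2 k, h, r => (h = 1 ∨ h = -1) ∧ (∀ cx cy, V cx cy → h * cx ≤ h * x) ∧
      (∀ cx cy, V cx cy → cy = r → cx = x ∨ h * cx ≤ h * (x - h * (k + 1))) ∧
      V (x - h * (k + 1)) r ∧ ∀ j : ℤ, 0 ≤ j → j ≤ k + 1 → V (x - h * j) (1 - r)
  | cor j, h, r => (h = 1 ∨ h = -1) ∧ (∀ i : ℤ, 1 ≤ i → i ≤ j → ¬ V (x + h * i) r) ∧ V (x + h * (j + 1)) r ∧
      (∀ i : ℤ, 0 ≤ i → i ≤ j → V (x + h * i) (1 - r)) ∧ V (x - h) r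

section steps

variable {x : ℤ} {V : ℤ → ℤ → Prop} {h r h' r' : ℤ} {ℓ : Step} {s' : LState}

/-- The visited predicate after one more letter. [cite: MadrasSlade1993, §1.1] -/
def V' (V : ℤ → ℤ → Prop) (nx ny : ℤ) : ℤ → ℤ → Prop := fun cx cy => V cx cy ∨ (cx = nx ∧ cy = ny)

/-- What one letter must satisfy for the walk to stay good (fresh site, in the strip) — arithmetic form. [cite: MadrasSlade1993, §1.1] -/
def StepOK (V : ℤ → ℤ → Prop) (x r : ℤ) (ℓ : Step) : Prop :=
  ¬ V (x + Step.dx ℓ) (r + Step.dy ℓ) ∧ (r + Step.dy ℓ = 0 ∨ r + Step.dy ℓ = 1)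

/-- Transport of a `V`-fact along provably equal coordinates. [folklore] -/
private theorem vcongr {V : ℤ → ℤ → Prop} {a b a' b' : ℤ} (hv : V a b) (ha : a = a') (hb : b = b') : V a' b' := by
  subst ha hb; exact hv

/-- Each letter is horizontal (`dx = ±1`, `dy = 0`) or vertical (`dx = 0`, `dy = ±1`). [folklore] -/
private theorem step_cases (ℓ : Step) :
    (Step.dy ℓ = 0 ∧ (Step.dx ℓ = 1 ∨ Step.dx ℓ = -1)) ∨ (Step.dx ℓ = 0 ∧ (Step.dy ℓ = 1 ∨ Step.dy ℓ = -1)) := by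
  fin_cases ℓ <;> simp [Step.dx, Step.dy]

/-- **Anatomy of a successful transition.** [cite: Stanley2012EC1, §4.7] -/
theorem δ_eq_some {s : LState} (hδ : δ ⟨s, h, r⟩ ℓ = some ⟨s', h', r'⟩) :
    (Step.dy ℓ = 0 ∧ (Step.dx ℓ = 1 ∨ Step.dx ℓ = -1) ∧ h' = Step.dx ℓ ∧ r' = r ∧
        ((h ≠ 0 ∧ Step.dx ℓ = -h ∧ backT s = some s') ∨ ((h = 0 ∨ Step.dx ℓ ≠ -h) ∧ fwdT s = some s'))) ∨
      (Step.dx ℓ = 0 ∧ Step.dy ℓ = 1 - 2 * r ∧ h' = h ∧ r' = 1 - r ∧ rungT s = some s') := by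
  unfold δ at hδ
  rcases step_cases ℓ with ⟨hdy, hdx⟩ | ⟨hdx, hdy⟩
  · left
    rw [if_pos hdy] at hδ
    refine ⟨hdy, hdx, ?_⟩
    by_cases hb : h ≠ 0 ∧ Step.dx ℓ = -h
    · rw [if_pos hb] at hδ
      cases hB : backT s with
      | none => rw [hB] at hδ; simp at hδ
      | some t =>
        rw [hB, Option.map_some, Option.some.injEq, GState.mk.injEq] at hδ
        exact ⟨hδ.2.1.symm, hδ.2.2.symm, Or.inl ⟨hb.1, hb.2, by rw [hδ.1]⟩⟩
    · rw [if_neg hb] at hδ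
      cases hF : fwdT s with
      | none => rw [hF] at hδ; simp at hδ
      | some t =>
        rw [hF, Option.map_some, Option.some.injEq, GState.mk.injEq] at hδ
        refine ⟨hδ.2.1.symm, hδ.2.2.symm, Or.inr ⟨?_, by rw [hδ.1]⟩⟩
        by_cases h0 : h = 0
        · exact Or.inl h0
        · exact Or.inr fun hx => hb ⟨h0, hx⟩
  · right
    have hdy0 : Step.dy ℓ ≠ 0 := by omega
    rw [if_neg hdy0] at hδ
    by_cases hv : Step.dy ℓ = 1 - 2 * r
    · rw [if_pos hv] at hδ
      cases hR : rungT s with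
      | none => rw [hR] at hδ; simp at hδ
      | some t =>
        rw [hR, Option.map_some, Option.some.injEq, GState.mk.injEq] at hδ
        exact ⟨hdx, hv, hδ.2.1.symm, hδ.2.2.symm, by rw [hδ.1]⟩
    · rw [if_neg hv] at hδ; simp at hδ

/-- When a good letter is offered, the transition succeeds — generic reduction. [cite: Stanley2012EC1, §4.7] -/
theorem δ_isSome_of {s : LState} (hr : r = 0 ∨ r = 1)
    (hfwd : Step.dy ℓ = 0 → (h = 0 ∨ Step.dx ℓ ≠ -h) → (fwdT s).isSome)
    (hback : Step.dy ℓ = 0 → h ≠ 0 → Step.dx ℓ = -h → (backT s).isSome)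
    (hrung : Step.dx ℓ = 0 → Step.dy ℓ = 1 - 2 * r → (rungT s).isSome)
    (hstrip : r + Step.dy ℓ = 0 ∨ r + Step.dy ℓ = 1) : (δ ⟨s, h, r⟩ ℓ).isSome := by
  unfold δ
  rcases step_cases ℓ with ⟨hdy, hdx⟩ | ⟨hdx, hdy⟩
  · rw [if_pos hdy]
    by_cases hb : h ≠ 0 ∧ Step.dx ℓ = -h
    · rw [if_pos hb]; have := hback hdy hb.1 hb.2; rw [Option.isSome_iff_exists] at this ⊢
      obtain ⟨t, ht⟩ := this; exact ⟨_, by rw [ht]; rfl⟩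
    · rw [if_neg hb]
      have := hfwd hdy (by by_cases h0 : h = 0; exact Or.inl h0; exact Or.inr fun hx => hb ⟨h0, hx⟩)
      rw [Option.isSome_iff_exists] at this ⊢
      obtain ⟨t, ht⟩ := this; exact ⟨_, by rw [ht]; rfl⟩
  · have hdy0 : Step.dy ℓ ≠ 0 := by omega
    have hv : Step.dy ℓ = 1 - 2 * r := by omega
    rw [if_neg hdy0, if_pos hv]
    have := hrung hdx hv; rw [Option.isSome_iff_exists] at this ⊢
    obtain ⟨t, ht⟩ := this; exact ⟨_, by rw [ht]; rfl⟩

/-- The conclusion of a successful transition: the letter is good and the invariant propagates. [cite: Stanley2012EC1, §4.7] -/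
def StepConcl (x : ℤ) (V : ℤ → ℤ → Prop) (r : ℤ) (ℓ : Step) (s' : LState) (h' r' : ℤ) : Prop :=
  StepOK V x r ℓ ∧ r' = r + Step.dy ℓ ∧ InvS (x + Step.dx ℓ) (V' V (x + Step.dx ℓ) (r + Step.dy ℓ)) s' h' r'

/-! ### `start` -/

/-- Transition from `start`. [cite: Stanley2012EC1, §4.7] -/
theorem step_start (hI : InvS x V start h r) (hδ : δ ⟨start, h, r⟩ ℓ = some ⟨s', h', r'⟩) :
    StepConcl x V r ℓ s' h' r' := by
  obtain ⟨rfl, rfl, rfl, hV0, hV⟩ := hI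
  rcases δ_eq_some hδ with ⟨hdy, hdx, rfl, rfl, ⟨h0, -, -⟩ | ⟨-, hs'⟩⟩ | ⟨hdx, hdy, rfl, rfl, hs'⟩
  · exact absurd rfl h0
  · simp only [fwdT, Option.some.injEq] at hs'; subst hs'
    refine ⟨⟨fun hv => ?_, by omega⟩, by omega, hdx, by omega, by push_cast; omega, ?_, ?_⟩
    · have := hV _ _ hv; omega
    · rintro cx cy (hv | ⟨rfl, rfl⟩)
      · have := hV _ _ hv; rcases hdx with hdx | hdx <;> rw [hdx] <;> exact ⟨by omega, by omega, by omega⟩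
      · rcases hdx with hdx | hdx <;> rw [hdx] <;> exact ⟨by omega, by omega, by omega⟩
    · intro j hj0 hj1
      rcases (show j = 0 ∨ j = 1 by push_cast at hj1; omega) with rfl | rfl
      · exact Or.inl (vcongr hV0 (by ring) rfl)
      · exact Or.inr ⟨by ring, by omega⟩
  · simp only [rungT, Option.some.injEq] at hs'; subst hs'
    refine ⟨⟨fun hv => ?_, by omega⟩, by omega, by omega, by rw [hdx]; ring, fun _ => rfl, fun h0 => absurd rfl h0,
      ?_, ?_⟩
    · have := hV _ _ hv; omega
    · rintro cx cy (hv | ⟨rfl, rfl⟩)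
      · right; have := hV _ _ hv; refine ⟨this.2, by omega, by omega, fun _ => this.1⟩
      · left; exact ⟨rfl, by omega⟩
    · intro j hj0 hj1
      exact Or.inl (vcongr hV0 (by push_cast at hj1; nlinarith) rfl)

/-- Blocking at `start`. [cite: Stanley2012EC1, §4.7] -/
theorem block_start (hI : InvS x V start h r) (hOK : StepOK V x r ℓ) : (δ ⟨start, h, r⟩ ℓ).isSome := by
  obtain ⟨rfl, rfl, rfl, -, -⟩ := hI
  obtain ⟨-, hstrip⟩ := hOK
  exact δ_isSome_of (Or.inl rfl) (fun _ _ => by simp [fwdT]) (fun _ h0 _ => absurd rfl h0) (fun _ _ => by simp [rungT]) hstrip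

/-! ### `ini k` -/

/-- Transition from `ini k`. [cite: Stanley2012EC1, §4.7] -/
theorem step_ini {k : ℕ} (hI : InvS x V (ini k) h r) (hδ : δ ⟨ini k, h, r⟩ ℓ = some ⟨s', h', r'⟩) :
    StepConcl x V r ℓ s' h' r' := by
  obtain ⟨hh, rfl, hx, hV, hrun⟩ := hI
  rcases δ_eq_some hδ with ⟨hdy, hdx, rfl, rfl, ⟨-, -, hs⟩ | ⟨h01, hs⟩⟩ | ⟨hdx, hdy, rfl, rfl, hs⟩
  · simp [backT] at hs
  · simp only [fwdT, Option.some.injEq] at hs; subst hs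
    have hdxh : Step.dx ℓ = h := by rcases hh with rfl | rfl <;> omega
    rw [StepConcl, hdxh]
    rcases hh with rfl | rfl
    all_goals
      refine ⟨⟨fun hv => ?_, by omega⟩, by omega, by norm_num, by omega, by push_cast at hx ⊢; omega, ?_, ?_⟩
      · have := hV _ _ hv; omega
      · rintro cx cy (hv | ⟨rfl, rfl⟩)
        · have := hV _ _ hv; push_cast at this ⊢; omega
        · push_cast at hx ⊢; omega
      · intro j hj0 hj1
        push_cast at hj1 hx
        by_cases hj : j ≤ (k : ℤ) + 1
        · exact Or.inl (hrun j hj0 hj)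
        · exact Or.inr ⟨by omega, by omega⟩
  · simp only [rungT, Option.some.injEq] at hs; subst hs
    refine ⟨⟨fun hv => ?_, by omega⟩, by omega, by omega, by rw [hx, hdx]; push_cast; ring,
      fun h0 => absurd h0 (Nat.succ_ne_zero k), fun _ => hh, ?_, ?_⟩
    · have := hV _ _ hv; omega
    · rintro cx cy (hv | ⟨rfl, rfl⟩)
      · right; have := hV _ _ hv
        exact ⟨this.1, this.2.1, by push_cast; exact this.2.2, fun h0 => absurd h0 (Nat.succ_ne_zero k)⟩
      · left; exact ⟨rfl, by omega⟩
    · intro j hj0 hj1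
      exact Or.inl (hrun j hj0 (by push_cast at hj1; exact hj1))

/-- Blocking at `ini k`. [cite: Stanley2012EC1, §4.7] -/
theorem block_ini {k : ℕ} (hI : InvS x V (ini k) h r) (hOK : StepOK V x r ℓ) : (δ ⟨ini k, h, r⟩ ℓ).isSome := by
  obtain ⟨hh, rfl, hx, hV, hrun⟩ := hI
  obtain ⟨hfresh, hstrip⟩ := hOK
  refine δ_isSome_of (Or.inl rfl) (fun _ _ => by simp [fwdT]) (fun hdy h0 hdx => ?_) (fun _ _ => by simp [rungT]) hstrip
  exfalso; apply hfresh
  exact vcongr (hrun k (by positivity) (by omega)) (by rcases hh with rfl | rfl <;> omega) (by omega)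

/-! ### `rg1 a` -/

/-- Transition from `rg1 a`. [cite: Stanley2012EC1, §4.7] -/
theorem step_rg1 {A : ℕ} (hcur : V x r) (hI : InvS x V (rg1 A) h r) (hδ : δ ⟨rg1 A, h, r⟩ ℓ = some ⟨s', h', r'⟩) :
    StepConcl x V r ℓ s' h' r' := by
  obtain ⟨rfl, hx, hA0, hA1, hV, hrun⟩ := hI
  rcases δ_eq_some hδ with ⟨hdy, hdx, rfl, rfl, ⟨hne, hback, hs⟩ | ⟨h01, hs⟩⟩ | ⟨hdx, hdy, rfl, rfl, hs⟩
  · cases A with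
    | zero => exact absurd (hA0 rfl) hne
    | succ j =>
      simp only [backT, Option.some.injEq] at hs; subst hs
      have hh := hA1 (Nat.succ_ne_zero j)
      rw [StepConcl, hback]
      rcases hh with rfl | rfl <;> push_cast at hx hV hrun ⊢
      all_goals
        refine ⟨⟨fun hv => ?_, by omega⟩, by omega, by norm_num, by omega, by omega, j + 1, le_rfl, ?_, ?_, ?_⟩
        · rcases hV _ _ hv with hv' | hv' <;> omega
        · intro i hi0 hi1; exact Or.inl (vcongr (hrun i hi0 (by push_cast at hi1 ⊢; omega)) (by omega) rfl)
        · intro i hi0 hi1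
          push_cast at hi0 hi1
          rcases (show i = j ∨ i = j + 1 by omega) with rfl | rfl
          · exact Or.inr ⟨by omega, by omega⟩
          · exact Or.inl (vcongr hcur (by omega) rfl)
        · rintro cx cy (hv | ⟨rfl, rfl⟩)
          · rcases hV _ _ hv with ⟨rfl, rfl⟩ | ⟨rfl, h1, h2, -⟩
            · right; push_cast; refine ⟨by trivial, by omega, by omega⟩
            · left; push_cast; refine ⟨by trivial, by omega, by omega⟩
          · right; push_cast; refine ⟨by omega, by omega, by omega⟩
  · simp only [fwdT, Option.some.injEq] at hs; subst hs
    have hold : ∀ cx cy, V cx cy → (cx = x ∧ cy = 1) ∨ (cy = 0 ∧ Step.dx ℓ * cx ≤ Step.dx ℓ * x) := by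
      intro cx cy hv
      rcases hV _ _ hv with hv' | ⟨hcy, h1, h2, h3⟩
      · exact Or.inl hv'
      · right; refine ⟨hcy, ?_⟩
        rcases Nat.eq_zero_or_pos A with hA | hA
        · rw [h3 hA, hx, hA0 hA]; simp
        · have hh := hA1 (by omega)
          have hdxh : Step.dx ℓ = h := by rcases hh with rfl | rfl <;> omega
          rw [hdxh]; rcases hh with rfl | rfl <;> omega
    have hend : V x 0 := vcongr (hrun A (by positivity) le_rfl) (by rw [hx]) rfl
    rw [StepConcl]
    rcases hdx with hd | hd <;> rw [hd] at hold ⊢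
    all_goals
      refine ⟨⟨fun hv => ?_, by omega⟩, by omega, by norm_num, ?_, ?_, ?_, ?_⟩
      · rcases hold _ _ hv with hv' | hv' <;> omega
      · rintro cx cy (hv | ⟨rfl, rfl⟩)
        · right; rcases hold _ _ hv with ⟨rfl, rfl⟩ | ⟨-, h1⟩ <;> omega
        · left; exact ⟨rfl, by omega⟩
      · rintro cx cy (hv | ⟨rfl, rfl⟩) hcy
        · rcases hold _ _ hv with ⟨rfl, rfl⟩ | ⟨-, h1⟩ <;> push_cast <;> omega
        · omega
      · exact Or.inl (vcongr hend (by push_cast; omega) (by omega))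
      · intro j hj0 hj1
        push_cast at hj1
        rcases (show j = 0 ∨ j = 1 by omega) with rfl | rfl
        · exact Or.inr ⟨by omega, by omega⟩
        · exact Or.inl (vcongr hcur (by omega) rfl)
  · simp [rungT] at hs

/-- Blocking at `rg1 a`. [cite: Stanley2012EC1, §4.7] -/
theorem block_rg1 {A : ℕ} (hI : InvS x V (rg1 A) h r) (hOK : StepOK V x r ℓ) : (δ ⟨rg1 A, h, r⟩ ℓ).isSome := by
  obtain ⟨rfl, hx, hA0, hA1, hV, hrun⟩ := hI
  obtain ⟨hfresh, hstrip⟩ := hOK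
  refine δ_isSome_of (Or.inr rfl) (fun _ _ => by simp [fwdT]) (fun hdy h0 hdx => ?_) (fun hdx hdy => ?_) hstrip
  · cases A with
    | zero => exact absurd (hA0 rfl) h0
    | succ j => simp [backT]
  · exfalso; apply hfresh
    exact vcongr (hrun A (by positivity) le_rfl) (by rw [hx, hdx]; ring) (by omega)

/-! ### `ut i` -/

/-- Transition from `ut i`. [cite: Stanley2012EC1, §4.7] -/
theorem step_ut {i : ℕ} (hcur : V x r) (hI : InvS x V (ut i) h r) (hδ : δ ⟨ut i, h, r⟩ ℓ = some ⟨s', h', r'⟩) :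
    StepConcl x V r ℓ s' h' r' := by
  obtain ⟨hh, rfl, hx, A, hiA, hinit, hut, hV⟩ := hI
  rcases δ_eq_some hδ with ⟨hdy, hdx, rfl, rfl, ⟨-, -, hs⟩ | ⟨h01, hs⟩⟩ | ⟨hdx, hdy, rfl, rfl, hs⟩
  · simp [backT] at hs
  · have hdxh : Step.dx ℓ = h := by rcases hh with rfl | rfl <;> omega
    rw [StepConcl, hdxh]
    cases i with
    | zero =>
      -- passing the start: into the forward phase `fwd 0`, measured from the starting column
      simp only [fwdT, Option.some.injEq] at hs; subst hs
      rcases hh with rfl | rfl <;> push_cast at hx hV hut hinit ⊢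
      all_goals
        refine ⟨⟨fun hv => ?_, by omega⟩, by omega, by norm_num, ?_, ?_,
          Or.inl (vcongr (hinit 0 le_rfl (by positivity)) (by omega) (by omega)), ?_⟩
        · rcases hV _ _ hv with hv' | hv' <;> omega
        · rintro cx cy (hv | ⟨rfl, rfl⟩)
          · right; rcases hV _ _ hv with hv' | hv' <;> omega
          · left; exact ⟨by omega, by omega⟩
        · rintro cx cy (hv | ⟨rfl, rfl⟩) hcy
          · rcases hV _ _ hv with hv' | hv' <;> omega
          · omega
        · intro j hj0 hj1
          rcases (show j = 0 ∨ j = 1 by omega) with rfl | rfl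
          · exact Or.inr ⟨by omega, by omega⟩
          · exact Or.inl (vcongr hcur (by omega) (by omega))
    | succ i =>
      simp only [fwdT, Option.some.injEq] at hs; subst hs
      rcases hh with rfl | rfl <;> push_cast at hx hV hut hinit hiA ⊢
      all_goals
        refine ⟨⟨fun hv => ?_, by omega⟩, by omega, by norm_num, rfl, by omega, A, by omega, ?_, ?_, ?_⟩
        · rcases hV _ _ hv with hv' | hv' <;> omega
        · intro j hj0 hj1; exact Or.inl (hinit j hj0 hj1)
        · intro j hj0 hj1
          by_cases hj : (i : ℤ) + 1 ≤ j
          · exact Or.inl (vcongr (hut j hj hj1) (by omega) rfl)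
          · exact Or.inr ⟨by omega, by omega⟩
        · rintro cx cy (hv | ⟨rfl, rfl⟩)
          · rcases hV _ _ hv with ⟨rfl, h1, h2⟩ | ⟨rfl, h1, h2⟩
            · exact Or.inl ⟨rfl, by omega, by omega⟩
            · exact Or.inr ⟨rfl, by omega, by omega⟩
          · exact Or.inr ⟨by omega, by omega, by omega⟩
  · simp [rungT] at hs

/-- Blocking at `ut i`. [cite: Stanley2012EC1, §4.7] -/
theorem block_ut {i : ℕ} (hI : InvS x V (ut i) h r) (hOK : StepOK V x r ℓ) : (δ ⟨ut i, h, r⟩ ℓ).isSome := by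
  obtain ⟨hh, rfl, hx, A, hiA, hinit, hut, -⟩ := hI
  obtain ⟨hfresh, hstrip⟩ := hOK
  refine δ_isSome_of (Or.inr rfl) (fun _ _ => by cases i <;> simp [fwdT]) (fun hdy h0 hdx => ?_) (fun hdx hdy => ?_) hstrip
  · exfalso; apply hfresh
    exact vcongr (hut (i + 1) (by omega) (by exact_mod_cast hiA)) (by rcases hh with rfl | rfl <;> omega) (by omega)
  · exfalso; apply hfresh
    exact vcongr (hinit i (by positivity) (by omega)) (by rw [hx, hdx]; ring) (by omega)

/-! ### `fwd k` -/

/-- Transition from `fwd k`. [cite: Stanley2012EC1, §4.7] -/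
theorem step_fwd {k : ℕ} (hr : r = 0 ∨ r = 1) (hcur : V x r) (hI : InvS x V (fwd k) h r)
    (hδ : δ ⟨fwd k, h, r⟩ ℓ = some ⟨s', h', r'⟩) : StepConcl x V r ℓ s' h' r' := by
  obtain ⟨hh, hF1, hF2, hF3, hrun⟩ := hI
  rcases δ_eq_some hδ with ⟨hdy, hdx, rfl, rfl, ⟨-, -, hs⟩ | ⟨h01, hs⟩⟩ | ⟨hdx, hdy, rfl, rfl, hs⟩
  · simp [backT] at hs
  · simp only [fwdT, Option.some.injEq] at hs; subst hs
    have hdxh : Step.dx ℓ = h := by rcases hh with rfl | rfl <;> omega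
    rw [StepConcl, hdxh]
    rcases hh with rfl | rfl
    all_goals
      refine ⟨⟨fun hv => ?_, by omega⟩, by omega, by norm_num, ?_, ?_, Or.inl (vcongr hF3 (by omega) (by omega)), ?_⟩
      · rcases hF1 _ _ hv with hv' | hv' <;> omega
      · rintro cx cy (hv | ⟨rfl, rfl⟩)
        · right; rcases hF1 _ _ hv with hv' | hv' <;> omega
        · left; exact ⟨rfl, by omega⟩
      · rintro cx cy (hv | ⟨rfl, rfl⟩) hcy
        · have := hF2 _ _ hv hcy; omega
        · omega
      · intro j hj0 hj1
        by_cases hj : 1 ≤ j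
        · exact Or.inl (vcongr (hrun (j - 1) (by omega) (by omega)) (by omega) rfl)
        · exact Or.inr ⟨by omega, by omega⟩
  · simp only [rungT, Option.some.injEq] at hs; subst hs
    rw [StepConcl, hdx]
    rcases hh with rfl | rfl
    all_goals
      refine ⟨⟨fun hv => ?_, by omega⟩, by omega, by norm_num, ?_, ?_, Or.inl (vcongr hF3 (by omega) (by omega)), ?_⟩
      · rcases hF1 _ _ hv with hv' | hv' <;> omega
      · rintro cx cy (hv | ⟨rfl, rfl⟩)
        · rcases hF1 _ _ hv with hv' | hv' <;> omega
        · omega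
      · rintro cx cy (hv | ⟨rfl, rfl⟩) hcy
        · right; exact hF2 _ _ hv (by omega) |>.trans (by omega)
        · left; omega
      · intro j hj0 hj1
        exact Or.inl (vcongr (hrun j hj0 hj1) (by omega) (by omega))

/-- Blocking at `fwd k`. [cite: Stanley2012EC1, §4.7] -/
theorem block_fwd {k : ℕ} (hr : r = 0 ∨ r = 1) (hI : InvS x V (fwd k) h r) (hOK : StepOK V x r ℓ) :
    (δ ⟨fwd k, h, r⟩ ℓ).isSome := by
  obtain ⟨-, -, -, -, hrun⟩ := hI
  obtain ⟨hfresh, hstrip⟩ := hOK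
  refine δ_isSome_of hr (fun _ _ => by simp [fwdT]) (fun hdy h0 hdx => ?_) (fun _ _ => by simp [rungT]) hstrip
  exfalso; apply hfresh
  exact vcongr (hrun 1 (by omega) (by omega)) (by rw [hdx]; ring) (by omega)

/-! ### `rg2 k` -/

/-- Transition from `rg2 k`. [cite: Stanley2012EC1, §4.7] -/
theorem step_rg2 {k : ℕ} (hr : r = 0 ∨ r = 1) (hcur : V x r) (hI : InvS x V (rg2 k) h r)
    (hδ : δ ⟨rg2 k, h, r⟩ ℓ = some ⟨s', h', r'⟩) : StepConcl x V r ℓ s' h' r' := by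
  obtain ⟨hh, hR1, hR2, hR3, hR6⟩ := hI
  rcases δ_eq_some hδ with ⟨hdy, hdx, rfl, rfl, ⟨hne, hback, hs⟩ | ⟨h01, hs⟩⟩ | ⟨hdx, hdy, rfl, rfl, hs⟩
  · cases k with
    | zero => simp [backT] at hs
    | succ j =>
      simp only [backT, Option.some.injEq] at hs; subst hs
      rw [StepConcl, hback]
      rcases hh with rfl | rfl <;> push_cast at hR1 hR2 hR3 hR6 ⊢
      all_goals
        refine ⟨⟨fun hv => ?_, by omega⟩, by omega, by norm_num, ?_, Or.inl (vcongr hR3 (by omega) rfl), ?_,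
          Or.inl (vcongr hcur (by omega) rfl)⟩
        · rcases hR2 _ _ hv (by omega) with hv' | hv' <;> omega
        · rintro i hi0 hi1 (hv | ⟨h1, h2⟩)
          · rcases hR2 _ _ hv rfl with hv' | hv' <;> omega
          · omega
        · intro i hi0 hi1
          exact Or.inl (vcongr (hR6 (i + 1) (by omega) (by omega)) (by omega) rfl)
  · simp only [fwdT, Option.some.injEq] at hs; subst hs
    have hdxh : Step.dx ℓ = h := by rcases hh with rfl | rfl <;> omega
    rw [StepConcl, hdxh]
    rcases hh with rfl | rfl
    all_goals
      refine ⟨⟨fun hv => ?_, by omega⟩, by omega, by norm_num, ?_, ?_, Or.inl (vcongr (hR6 0 le_rfl (by positivity)) (by omega) rfl), ?_⟩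
      · have := hR1 _ _ hv; omega
      · rintro cx cy (hv | ⟨rfl, rfl⟩)
        · right; have := hR1 _ _ hv; omega
        · left; exact ⟨rfl, by omega⟩
      · rintro cx cy (hv | ⟨rfl, rfl⟩) hcy
        · have := hR1 _ _ hv; omega
        · omega
      · intro j hj0 hj1
        rcases (show j = 0 ∨ j = 1 by omega) with rfl | rfl
        · exact Or.inr ⟨by omega, by omega⟩
        · exact Or.inl (vcongr hcur (by omega) rfl)
  · simp [rungT] at hs

/-- Blocking at `rg2 k`. [cite: Stanley2012EC1, §4.7] -/
theorem block_rg2 {k : ℕ} (hr : r = 0 ∨ r = 1) (hI : InvS x V (rg2 k) h r) (hOK : StepOK V x r ℓ) :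
    (δ ⟨rg2 k, h, r⟩ ℓ).isSome := by
  obtain ⟨hh, hR1, hR2, hR3, hR6⟩ := hI
  obtain ⟨hfresh, hstrip⟩ := hOK
  refine δ_isSome_of hr (fun _ _ => by simp [fwdT]) (fun hdy h0 hdx => ?_) (fun hdx hdy => ?_) hstrip
  · cases k with
    | zero =>
      exfalso; apply hfresh
      exact vcongr hR3 (by rw [hdx]; push_cast; ring) (by omega)
    | succ j => simp [backT]
  · exfalso; apply hfresh
    exact vcongr (hR6 0 le_rfl (by positivity)) (by rw [hdx]; ring) (by omega)

/-! ### `cor j` -/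

/-- Transition from `cor j`. [cite: Stanley2012EC1, §4.7] -/
theorem step_cor {j : ℕ} (hr : r = 0 ∨ r = 1) (hcur : V x r) (hI : InvS x V (cor j) h r)
    (hδ : δ ⟨cor j, h, r⟩ ℓ = some ⟨s', h', r'⟩) : StepConcl x V r ℓ s' h' r' := by
  obtain ⟨hh, hC1, hC2, hC3, hC4⟩ := hI
  rcases δ_eq_some hδ with ⟨hdy, hdx, rfl, rfl, ⟨-, -, hs⟩ | ⟨h01, hs⟩⟩ | ⟨hdx, hdy, rfl, rfl, hs⟩
  · simp [backT] at hs
  · cases j with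
    | zero => simp [fwdT] at hs
    | succ j =>
      simp only [fwdT, Option.some.injEq] at hs; subst hs
      have hdxh : Step.dx ℓ = h := by rcases hh with rfl | rfl <;> omega
      rw [StepConcl, hdxh]
      rcases hh with rfl | rfl <;> push_cast at hC1 hC2 hC3 hC4 ⊢
      all_goals
        refine ⟨⟨fun hv => hC1 1 le_rfl (by omega) (vcongr hv (by omega) (by omega)), by omega⟩, by omega,
          by norm_num, ?_, Or.inl (vcongr hC2 (by omega) rfl), ?_, Or.inl (vcongr hcur (by omega) rfl)⟩
        · rintro i hi0 hi1 (hv | ⟨h1, h2⟩)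
          · exact hC1 (i + 1) (by omega) (by omega) (vcongr hv (by omega) rfl)
          · omega
        · intro i hi0 hi1
          exact Or.inl (vcongr (hC3 (i + 1) (by omega) (by omega)) (by omega) rfl)
  · simp [rungT] at hs

/-- Blocking at `cor j`. [cite: Stanley2012EC1, §4.7] -/
theorem block_cor {j : ℕ} (hr : r = 0 ∨ r = 1) (hI : InvS x V (cor j) h r) (hOK : StepOK V x r ℓ) :
    (δ ⟨cor j, h, r⟩ ℓ).isSome := by
  obtain ⟨hh, -, hC2, hC3, hC4⟩ := hI
  obtain ⟨hfresh, hstrip⟩ := hOK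
  refine δ_isSome_of hr (fun hdy h01 => ?_) (fun hdy h0 hdx => ?_) (fun hdx hdy => ?_) hstrip
  · cases j with
    | zero =>
      exfalso; apply hfresh
      have hdxh : Step.dx ℓ = h := by
        rcases step_cases ℓ with ⟨-, hdx⟩ | ⟨-, hdy'⟩
        · rcases hh with rfl | rfl <;> omega
        · omega
      exact vcongr hC2 (by rw [hdxh]; push_cast; ring) (by omega)
    | succ j => simp [fwdT]
  · exfalso; apply hfresh
    exact vcongr hC4 (by rw [hdx]; ring) (by omega)
  · exfalso; apply hfresh
    exact vcongr (hC3 0 le_rfl (by positivity)) (by rw [hdx]; ring) (by omega)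

/-! ### All states at once -/

/-- **One successful transition from any state.** [cite: Stanley2012EC1, §4.7] -/
theorem step_all {s : LState} (hr : r = 0 ∨ r = 1) (hcur : V x r) (hI : InvS x V s h r)
    (hδ : δ ⟨s, h, r⟩ ℓ = some ⟨s', h', r'⟩) : StepConcl x V r ℓ s' h' r' := by
  cases s with
  | start => exact step_start hI hδ
  | ini k => exact step_ini hI hδ
  | rg1 a => exact step_rg1 hcur hI hδ
  | ut i => exact step_ut hcur hI hδ
  | fwd k => exact step_fwd hr hcur hI hδ
  | rg2 k => exact step_rg2 hr hcur hI hδ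
  | cor j => exact step_cor hr hcur hI hδ

/-- **A good letter is never rejected.** [cite: Stanley2012EC1, §4.7] -/
theorem block_all {s : LState} (hr : r = 0 ∨ r = 1) (hI : InvS x V s h r) (hOK : StepOK V x r ℓ) :
    (δ ⟨s, h, r⟩ ℓ).isSome := by
  cases s with
  | start => exact block_start hI hOK
  | ini k => exact block_ini hI hOK
  | rg1 a => exact block_rg1 hI hOK
  | ut i => exact block_ut hI hOK
  | fwd k => exact block_fwd hr hI hOK
  | rg2 k => exact block_rg2 hr hI hOK
  | cor j => exact block_cor hr hI hOK

end steps

/-! ## §9 Words: the automaton accepts exactly the good words; `#ladderWalks 0 N = zCount N` -/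

section accept

/-- The invariant of a word. [cite: Stanley2012EC1, §4.7] -/
def WInv (w : List Step) (g : GState) : Prop :=
  (wEnd w) 1 = g.r ∧ (g.r = 0 ∨ g.r = 1) ∧ InvS ((wEnd w) 0) (VisAt w) g.s g.h g.r

/-- **The main induction**: along a word, `Good` ⟺ accepted, with the invariant. [cite: Stanley2012EC1, §4.7] -/
theorem good_iff_run (w : List Step) :
    (Good w → ∃ g, run startG w = some g ∧ WInv w g) ∧ (∀ g, run startG w = some g → Good w ∧ WInv w g) := by
  induction w using List.reverseRecOn with
  | nil =>
    have hI : WInv [] startG := by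
      refine ⟨by simp [startG], Or.inl rfl, ?_⟩
      simp only [startG, InvS, wEnd_nil]
      exact ⟨by trivial, by trivial, by trivial, visAt_start, fun cx cy ⟨i, hi, h0, h1⟩ => by
        simp only [List.length_nil, Nat.le_zero] at hi; subst hi; simp at h0 h1; exact ⟨h0.symm, h1.symm⟩⟩
    refine ⟨fun _ => ⟨startG, rfl, hI⟩, fun g hg => ?_⟩
    simp only [run_nil, Option.some.injEq] at hg; subst hg
    exact ⟨good_nil, hI⟩
  | append_singleton w ℓ ih =>
    have key : ∀ g g', run startG w = some g → WInv w g → δ g ℓ = some g' → Good w → Good (w ++ [ℓ]) ∧ WInv (w ++ [ℓ]) g' := by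
      rintro ⟨s, h, r⟩ ⟨s', h', r'⟩ hrun ⟨hrow, hr, hI⟩ hδ hgood
      simp only at hrow hr hI
      obtain ⟨⟨hfresh, hstrip⟩, hr', hI'⟩ := step_all hr (by rw [← hrow]; exact visAt_end) hI hδ
      have hV : VisAt (w ++ [ℓ]) = V' (VisAt w) ((wEnd w) 0 + Step.dx ℓ) (r + Step.dy ℓ) := by
        funext cx cy; apply propext; unfold V'; rw [← hrow, visAt_snoc_iff]
        constructor <;> rintro (hv | ⟨h1, h2⟩) <;> first | exact Or.inl hv | exact Or.inr ⟨h1.symm, h2.symm⟩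
      have hpos0 : (wEnd (w ++ [ℓ])) 0 = (wEnd w) 0 + Step.dx ℓ := by simp
      have hpos1 : (wEnd (w ++ [ℓ])) 1 = (wEnd w) 1 + Step.dy ℓ := by simp
      refine ⟨(good_snoc_iff ℓ).2 ⟨hgood, by rw [hrow]; exact hfresh, by rw [hrow]; omega⟩, ?_⟩
      refine ⟨by rw [hpos1, hrow]; exact hr'.symm, by simp only; omega, ?_⟩
      simp only; rw [hpos0, hV]; convert hI' using 2
    refine ⟨fun hgood' => ?_, fun g' hrun' => ?_⟩
    · obtain ⟨hgood, hfresh, hstrip⟩ := (good_snoc_iff ℓ).1 hgood'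
      obtain ⟨g, hrun, hW⟩ := ih.1 hgood
      obtain ⟨hrow, hr, hI⟩ := hW
      have hOK : StepOK (VisAt w) ((wEnd w) 0) g.r ℓ := ⟨by rw [← hrow]; exact hfresh, by rw [← hrow]; omega⟩
      obtain ⟨g', hδ⟩ := Option.isSome_iff_exists.1 (block_all (s := g.s) (h := g.h) hr hI hOK)
      exact ⟨g', by rw [run_snoc, hrun, Option.bind_some, hδ], (key g g' hrun ⟨hrow, hr, hI⟩ hδ hgood).2⟩
    · rw [run_snoc] at hrun'
      obtain ⟨g, hrun, hδ⟩ := Option.bind_eq_some_iff.1 hrun'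
      obtain ⟨hgood, hW⟩ := ih.2 g hrun
      exact key g g' hrun hW hδ hgood

/-- ★★ **The automaton accepts exactly the step words of the self-avoiding walks of the ladder from a vertex.**
[cite: Stanley2012EC1, §4.7; GrimmettLi2014Bounds, §1] -/
theorem good_iff_isSome (w : List Step) : Good w ↔ (run startG w).isSome := by
  rw [Option.isSome_iff_exists]
  exact ⟨fun h => let ⟨g, hg, _⟩ := (good_iff_run w).1 h; ⟨g, hg⟩, fun ⟨g, hg⟩ => ((good_iff_run w).2 g hg).1⟩

open Classical in
/-- `ladderWalks 0 N` is the image of the accepted words under `traj`. [cite: GrimmettLi2014Bounds, §1 (σ_N)] -/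
theorem ladderWalks_eq_image (N : ℕ) : Ladder.ladderWalks 0 N = (acc startG N).image traj := by
  ext ω
  simp only [Finset.mem_image, acc, Finset.mem_filter, mem_words]
  constructor
  · intro hmem
    have hω : ω ∈ Zd.saws 2 N := by
      rw [Ladder.ladderWalks, Finset.mem_filter] at hmem; exact hmem.1
    refine ⟨wordOf N ω, ⟨length_wordOf N ω, ?_⟩, traj_wordOf hω⟩
    rw [← good_iff_isSome]
    have := (mem_ladderWalks_iff_good (w := wordOf N ω))
    rw [traj_wordOf hω, length_wordOf] at this
    exact this.1 hmem
  · rintro ⟨w, ⟨hlen, hacc⟩, rfl⟩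
    rw [← hlen]
    exact mem_ladderWalks_iff_good.2 ((good_iff_isSome w).2 hacc)

open Classical in
/-- ★★★ **The automaton counts the walks of the ladder from a vertex: `#ladderWalks 0 N = zCount N`** (Grimmett–Li's `σ_N(v)`
for the ladder `𝕃`). [cite: Zeilberger1996, Theorem; GrimmettLi2014Bounds, §1 (σ_N)] -/
theorem card_ladderWalks_eq_zCount (N : ℕ) : (Ladder.ladderWalks 0 N).card = zCount N := by
  rw [ladderWalks_eq_image, Finset.card_image_of_injOn, card_acc _ _ (by simp [HOk, startG]) (by simp [startG])]
  · rfl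
  · intro w hw w' hw' h
    simp only [Finset.mem_coe, acc, Finset.mem_filter, mem_words] at hw hw'
    exact eq_of_traj_eq (hw.1.trans hw'.1.symm) h

/-! ## §10 Zeilberger's theorem, as printed -/

/-- ★★★ **ZEILBERGER'S GENERATING FUNCTION** ("Theorem" of [Zeilberger 1996], the gf form in its proof):
`Σ_n a_n^{(2)} t^n = (1 + 2t − t³ − t⁴ + t⁷)/((1 − t)²(1 + t)²(1 − t − t²))`, where `a_n^{(2)}` = the number of `n`-step self-avoiding
walks in the strip `{0,1} × ℤ` from a vertex — here `#Ladder.ladderWalks 0 n` (the same strip up to the swap of coordinates).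
[cite: Zeilberger1996, Theorem (proof, final gf); Lindorfer2018, §6.2, eq. (6.14)] -/
theorem card_ladderWalks_series :
    PowerSeries.mk (fun N => ((Ladder.ladderWalks 0 N).card : ℤ)) * ((1 - X) ^ 2 * (1 + X) ^ 2 * (1 - X - X ^ 2)) =
      1 + 2 * X - X ^ 3 - X ^ 4 + X ^ 7 := by
  rw [show (PowerSeries.mk fun N => ((Ladder.ladderWalks 0 N).card : ℤ)) = PowerSeries.mk fun N => (zCount N : ℤ) from by
    ext N; rw [coeff_mk, coeff_mk, card_ladderWalks_eq_zCount]]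
  exact zCount_series

/-- ★★ The linear recurrence of `a_n^{(2)}`: `a_{n+8} = a_{n+7} + 3a_{n+6} − 2a_{n+5} − 3a_{n+4} + a_{n+3} + a_{n+2}`.
[cite: Zeilberger1996, Theorem; Stanley2012EC1, §4.1 (Theorem 4.1.1)] -/
theorem card_ladderWalks_rec (n : ℕ) :
    ((Ladder.ladderWalks 0 (n + 8)).card : ℤ) = (Ladder.ladderWalks 0 (n + 7)).card + 3 * (Ladder.ladderWalks 0 (n + 6)).card
      - 2 * (Ladder.ladderWalks 0 (n + 5)).card - 3 * (Ladder.ladderWalks 0 (n + 4)).card + (Ladder.ladderWalks 0 (n + 3)).card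
      + (Ladder.ladderWalks 0 (n + 2)).card := by
  simp only [card_ladderWalks_eq_zCount]; exact zCount_rec n

/-- Zeilberger's closed form as an integer function: `8 F_n − n` (`n` even), `8 F_n − 4` (`n` odd) — i.e.
`8F_n − (n/2)(1 + (−1)^n) − 2(1 − (−1)^n)`. [cite: Zeilberger1996, Theorem] -/
def zeil (n : ℕ) : ℤ := 8 * (Nat.fib n : ℤ) - (if Even n then (n : ℤ) else 4)

/-- `zeil` satisfies the same order-6 recurrence (the Fibonacci part is annihilated by `1 − t − t²`, the other by `(1 − t²)²`).
[cite: Zeilberger1996, Theorem] -/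
theorem zeil_rec (n : ℕ) :
    zeil (n + 8) = zeil (n + 7) + 3 * zeil (n + 6) - 2 * zeil (n + 5) - 3 * zeil (n + 4) + zeil (n + 3) + zeil (n + 2) := by
  have f2 : ∀ m, (Nat.fib (m + 2) : ℤ) = Nat.fib m + Nat.fib (m + 1) := fun m => by
    rw [Nat.fib_add_two]; push_cast; ring
  simp only [zeil]
  obtain ⟨j, rfl | rfl⟩ := Nat.even_or_odd' n
  · have e : ∀ k, Even (2 * j + k) ↔ Even k := fun k => by simp [Nat.even_add]
    simp only [e, show Even 8 by decide, show ¬ Even 7 by decide, show Even 6 by decide, show ¬ Even 5 by decide,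
      show Even 4 by decide, show ¬ Even 3 by decide, show Even 2 by decide, if_true, if_false]
    rw [f2 (2 * j + 6), f2 (2 * j + 5), f2 (2 * j + 4), f2 (2 * j + 3), f2 (2 * j + 2), f2 (2 * j + 1), f2 (2 * j)]
    push_cast; ring
  · have e : ∀ k, Even (2 * j + 1 + k) ↔ ¬ Even k := fun k => by
      simp [Nat.even_add]
    simp only [e, show Even 8 by decide, show ¬ Even 7 by decide, show Even 6 by decide, show ¬ Even 5 by decide,
      show Even 4 by decide, show ¬ Even 3 by decide, show Even 2 by decide, if_true, if_false, not_true, not_false_iff]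
    rw [f2 (2 * j + 1 + 6), f2 (2 * j + 1 + 5), f2 (2 * j + 1 + 4), f2 (2 * j + 1 + 3), f2 (2 * j + 1 + 2), f2 (2 * j + 1 + 1),
      f2 (2 * j + 1)]
    push_cast; ring

/-- `zCount n = zeil n` for `2 ≤ n ≤ 7` (the initial window of the recurrence). [cite: Zeilberger1996, Theorem] -/
theorem zCount_eq_zeil_small : ∀ n, 2 ≤ n → n ≤ 7 → (zCount n : ℤ) = zeil n := by decide

/-- ★★★ **ZEILBERGER'S THEOREM, AS PRINTED**: "The number, `a_n^{(2)}`, of `n`-step saws in the strip `{0,1} × [−∞, ∞]` is given by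
`a_0^{(2)} = 1`, `a_1^{(2)} = 3`, and for `n > 1`, by `a_n^{(2)} = 8F_n − (n/2)(1 + (−1)^n) − 2(1 − (−1)^n)`" — here for the tree's
`Ladder.ladderWalks 0 n` (walks of the ladder `ℤ × {0,1}` from a vertex), with the right-hand side as `zeil n`
(`= 8F_n − n` for even `n`, `8F_n − 4` for odd `n`). [cite: Zeilberger1996, Theorem] -/
theorem card_ladderWalks_eq_fib (n : ℕ) (hn : 2 ≤ n) : ((Ladder.ladderWalks 0 n).card : ℤ) = zeil n := by
  rw [card_ladderWalks_eq_zCount]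
  induction n using Nat.strong_induction_on with
  | _ n ih =>
    rcases Nat.lt_or_ge n 8 with hlt | hge
    · exact zCount_eq_zeil_small n hn (by omega)
    · obtain ⟨m, rfl⟩ : ∃ m, n = m + 8 := ⟨n - 8, by omega⟩
      rw [zCount_rec, zeil_rec, ih (m + 7) (by omega) (by omega), ih (m + 6) (by omega) (by omega),
        ih (m + 5) (by omega) (by omega), ih (m + 4) (by omega) (by omega), ih (m + 3) (by omega) (by omega),
        ih (m + 2) (by omega) (by omega)]

/-- The first values: `a_0^{(2)} = 1`, `a_1^{(2)} = 3` (as printed) and `a_2 … a_7 = 6, 12, 20, 36, 58, 100`.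
[cite: Zeilberger1996, Theorem] -/
theorem card_ladderWalks_values : (List.range 8).map (fun N => (Ladder.ladderWalks 0 N).card) = [1, 3, 6, 12, 20, 36, 58, 100] := by
  rw [show (fun N => (Ladder.ladderWalks 0 N).card) = zCount from funext card_ladderWalks_eq_zCount]; decide

/-! ## §11 The Madras–Slade tube count `c_N(R[1,1])` (walks of the ladder up to horizontal translation) -/

open Classical in
/-- The fibre of `Zd.tubePairs 2 1 1 N` over a starting site `a = (0, y₀)` is `ladderWalks y₀ N`.
[cite: MadrasSlade1993, §8.2, eq. (8.2.1)] -/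
theorem filter_tubePairs_eq (N : ℕ) {a : Site 2} (ha : a ∈ Zd.tubeStarts 2 1 1) :
    (Zd.tubePairs 2 1 1 N).filter (fun q => q.1 = a) = (Ladder.ladderWalks (a 1) N).image fun υ => (a, υ) := by
  ext q
  obtain ⟨b, υ⟩ := q
  simp only [Finset.mem_filter, Finset.mem_image, Prod.mk.injEq, Zd.mem_tubePairs, Ladder.ladderWalks]
  constructor
  · rintro ⟨⟨-, hυ, hin⟩, rfl⟩
    refine ⟨υ, ⟨hυ, fun m hm => ?_⟩, rfl, rfl⟩
    have := (hin m hm) 1 (by decide)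
    simpa using this
  · rintro ⟨υ', ⟨hυ, hin⟩, rfl, rfl⟩
    refine ⟨⟨ha, hυ, fun m hm i hi => ?_⟩, rfl⟩
    have hi1 : i = 1 := by ext; have := i.isLt; omega
    subst hi1
    simpa using hin m hm

/-- The starting sites of `R[1,1] ⊂ ℤ²`: `(0,0)` and `(0,1)`. [cite: MadrasSlade1993, §8.2, eq. (8.2.1)] -/
theorem tubeStarts_ladder : Zd.tubeStarts 2 1 1 = {![0, 0], ![0, 1]} := by
  ext a
  rw [Zd.mem_tubeStarts, Zd.InTube]
  simp only [Finset.mem_insert, Finset.mem_singleton, Fin.forall_fin_two, Fin.val_zero, Fin.val_one, Nat.cast_one]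
  constructor
  · rintro ⟨⟨-, h1⟩, h0, -⟩
    have e0 : a 0 = 0 := h0 (by omega)
    have e1 : a 1 = 0 ∨ a 1 = 1 := by have := h1 le_rfl; omega
    rcases e1 with e1 | e1 <;> [left; right] <;> (funext i; fin_cases i <;> assumption)
  · rintro (rfl | rfl) <;> refine ⟨⟨fun h => absurd h (by omega), fun _ => ⟨by simp, by simp⟩⟩, fun _ => rfl, fun h => absurd le_rfl h⟩

/-- ★★ **`c_N(R[1,1]) = 2 · zCount N`**: the walks of the ladder up to horizontal translation are the walks from `(0,0)` and
from `(0,1)`, equinumerous by the reflection (`Ladder.card_ladderWalks_one`). [cite: MadrasSlade1993, §8.2, eq. (8.2.1)] -/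
theorem tubeCount_ladder_eq (N : ℕ) : Zd.tubeCount 2 1 1 N = 2 * zCount N := by
  classical
  rw [Zd.tubeCount, Finset.card_eq_sum_card_fiberwise (f := Prod.fst) (t := Zd.tubeStarts 2 1 1)
    (fun q hq => (Zd.mem_tubePairs.1 hq).1)]
  rw [Finset.sum_congr rfl fun a ha => by rw [filter_tubePairs_eq N ha, Finset.card_image_of_injective _
    (fun υ υ' h => by simpa using h)], tubeStarts_ladder, Finset.sum_insert (by decide), Finset.sum_singleton]
  change (Ladder.ladderWalks 0 N).card + (Ladder.ladderWalks 1 N).card = _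
  rw [Ladder.card_ladderWalks_one, card_ladderWalks_eq_zCount]; ring

/-- ★★ **The series of the Madras–Slade tube count of the ladder**:
`(Σ_N c_N(R[1,1]) X^N) · (1 − X)²(1 + X)²(1 − X − X²) = 2 (1 + 2X − X³ − X⁴ + X⁷)`. [cite: MadrasSlade1993, §8.2, eq. (8.2.1); Zeilberger1996, Theorem] -/
theorem tubeCount_ladder_series :
    PowerSeries.mk (fun N => (Zd.tubeCount 2 1 1 N : ℤ)) * ((1 - X) ^ 2 * (1 + X) ^ 2 * (1 - X - X ^ 2)) =
      2 * (1 + 2 * X - X ^ 3 - X ^ 4 + X ^ 7) := by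
  rw [show (PowerSeries.mk fun N => (Zd.tubeCount 2 1 1 N : ℤ)) = 2 * PowerSeries.mk fun N => (zCount N : ℤ) from by
    ext N
    rw [coeff_mk, show (2 : ℤ⟦X⟧) = PowerSeries.C 2 from by simp, PowerSeries.coeff_C_mul, coeff_mk, tubeCount_ladder_eq]
    push_cast; ring]
  rw [mul_assoc, zCount_series]

/-- ★★ `c_n(R[1,1]) = 2 (8F_n − (n even: n; n odd: 4))` for `n ≥ 2`. [cite: MadrasSlade1993, §8.2; Zeilberger1996, Theorem] -/
theorem tubeCount_ladder_eq_fib (n : ℕ) (hn : 2 ≤ n) : (Zd.tubeCount 2 1 1 n : ℤ) = 2 * zeil n := by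
  rw [tubeCount_ladder_eq]; push_cast; rw [← card_ladderWalks_eq_zCount, card_ladderWalks_eq_fib n hn]

end accept

section amplitude

open Filter Topology

open scoped goldenRatio

/-! ### §12 (ed.4) Binet: `F_n / φⁿ → 1/√5`, and Zeilberger's correction term is negligible -/

/-- `F_n/φⁿ → 1/√5` (Binet's formula `F_n = (φⁿ − ψⁿ)/√5`, `|ψ/φ| < 1`).
[cite: Zeilberger1996, Theorem (the term 8F_n)] -/
theorem tendsto_fib_div_goldenRatio_pow :
    Tendsto (fun n : ℕ => (Nat.fib n : ℝ) / φ ^ n) atTop (𝓝 (1 / Real.sqrt 5)) := by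
  have hφ : (0 : ℝ) < φ := Real.goldenRatio_pos
  have hr : |ψ / φ| < 1 := by
    rw [abs_div, div_lt_one (abs_pos.2 hφ.ne'), abs_of_pos hφ]
    have h1 : ψ < 0 := Real.goldenConj_neg
    have h2 : -1 < ψ := Real.neg_one_lt_goldenConj
    have h3 : 1 < φ := Real.one_lt_goldenRatio
    rw [abs_of_neg h1]
    linarith
  have hlim : Tendsto (fun n : ℕ => (1 - (ψ / φ) ^ n) / Real.sqrt 5) atTop (𝓝 ((1 - 0) / Real.sqrt 5)) :=
    (tendsto_const_nhds.sub (tendsto_pow_atTop_nhds_zero_of_abs_lt_one hr)).div_const _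
  rw [sub_zero] at hlim
  refine hlim.congr fun n => ?_
  have hφn : φ ^ n ≠ 0 := pow_ne_zero _ hφ.ne'
  rw [Real.coe_fib_eq, div_pow]
  field_simp

/-- The correction term of Zeilberger's formula, `n` for even `n` and `4` for odd `n`, lies in `[0, n+4]`.
[cite: Zeilberger1996, Theorem] -/
theorem corr_mem_Icc (n : ℕ) : (if Even n then (n : ℝ) else 4) ∈ Set.Icc (0 : ℝ) (n + 4) := by
  split_ifs
  · exact ⟨Nat.cast_nonneg n, by linarith⟩
  · exact ⟨by norm_num, by linarith [Nat.cast_nonneg (α := ℝ) n]⟩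

/-- The correction term is negligible: `([n even]·n + [n odd]·4) / φⁿ → 0`. [cite: Zeilberger1996, Theorem] -/
theorem tendsto_corr_div_pow :
    Tendsto (fun n : ℕ => (if Even n then (n : ℝ) else 4) / φ ^ n) atTop (𝓝 0) := by
  have h3 : 1 < φ := Real.one_lt_goldenRatio
  have hφ : (0 : ℝ) < φ := Real.goldenRatio_pos
  have hA : Tendsto (fun n : ℕ => (n : ℝ) ^ 1 / φ ^ n) atTop (𝓝 0) :=
    tendsto_pow_const_div_const_pow_of_one_lt 1 h3
  have hB : Tendsto (fun n : ℕ => (4 : ℝ) / φ ^ n) atTop (𝓝 0) :=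
    tendsto_const_nhds.div_atTop (tendsto_pow_atTop_atTop_of_one_lt h3)
  have hS : Tendsto (fun n : ℕ => (n : ℝ) ^ 1 / φ ^ n + 4 / φ ^ n) atTop (𝓝 0) := by
    simpa using hA.add hB
  refine tendsto_of_tendsto_of_tendsto_of_le_of_le tendsto_const_nhds hS (fun n => ?_) fun n => ?_
  · exact div_nonneg (corr_mem_Icc n).1 (pow_pos hφ n).le
  · have hφn : 0 < φ ^ n := pow_pos hφ n
    rw [pow_one, ← add_div, div_le_div_iff_of_pos_right hφn]
    exact (corr_mem_Icc n).2

/-- `zeil n = 8F_n − ([n even]·n + [n odd]·4)` over `ℝ`. [cite: Zeilberger1996, Theorem] -/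
theorem cast_zeil (n : ℕ) : (zeil n : ℝ) = 8 * (Nat.fib n : ℝ) - (if Even n then (n : ℝ) else 4) := by
  unfold zeil
  split_ifs <;> push_cast <;> ring

/-- `zeil n / φⁿ → 8/√5`. [cite: Zeilberger1996, Theorem] -/
theorem tendsto_zeil_div_pow : Tendsto (fun n : ℕ => (zeil n : ℝ) / φ ^ n) atTop (𝓝 (8 / Real.sqrt 5)) := by
  have h := (tendsto_fib_div_goldenRatio_pow.const_mul 8).sub tendsto_corr_div_pow
  have hl : (8 : ℝ) * (1 / Real.sqrt 5) - 0 = 8 / Real.sqrt 5 := by ring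
  rw [hl] at h
  refine h.congr fun n => ?_
  rw [cast_zeil]
  ring

/-! ### §13 (ed.4) The amplitude of the ladder: `a_n ∼ (8/√5)·φⁿ` -/

/-- ★ **Amplitude of self-avoiding walks on the ladder**: the number `a_n` of `n`-step self-avoiding walks on
`ℤ × {0,1}` from a fixed vertex satisfies `a_n / φⁿ → 8/√5`, i.e. `a_n ∼ (8/√5)·φⁿ` (`φ` the golden ratio) — the
leading term `8F_n` of Zeilberger's exact formula `a_n = 8F_n − [n even]·n − [n odd]·4` (`card_ladderWalks_eq_fib`);
in Madras–Slade's notation `c_n ∼ A μⁿ n^{γ−1}` with `μ = φ`, `γ = 1`, `A = 8/√5`.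
[cite: Zeilberger1996, Theorem (corollary)] [cite: MadrasSlade1993, §1.1 (c_N ∼ Aμ^N N^{γ−1}: the amplitude A and the exponent γ)] -/
theorem tendsto_card_ladderWalks_div_pow :
    Tendsto (fun n : ℕ => ((Ladder.ladderWalks 0 n).card : ℝ) / φ ^ n) atTop (𝓝 (8 / Real.sqrt 5)) := by
  refine tendsto_zeil_div_pow.congr' ?_
  filter_upwards [eventually_ge_atTop 2] with n hn
  have h : (((Ladder.ladderWalks 0 n).card : ℤ) : ℝ) = (zeil n : ℝ) := by rw [card_ladderWalks_eq_fib n hn]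
  rw [← h]
  push_cast
  rfl

/-- ★ The same for the Madras–Slade tube `R[1,1] = ℤ × {0,1}` counted up to translation (`Zd.tubeCount 2 1 1 n =
2·a_n`, `tubeCount_ladder_eq_fib`): `c_n(R[1,1]) / φⁿ → 16/√5`.
[cite: Zeilberger1996, Theorem (corollary)] [cite: MadrasSlade1993, §8.2 (walks in a tube; c_N(R) ∼ growth at rate μ(R))] -/
theorem tendsto_tubeCount_ladder_div_pow :
    Tendsto (fun n : ℕ => (Zd.tubeCount 2 1 1 n : ℝ) / φ ^ n) atTop (𝓝 (16 / Real.sqrt 5)) := by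
  have h := tendsto_zeil_div_pow.const_mul 2
  have hl : (2 : ℝ) * (8 / Real.sqrt 5) = 16 / Real.sqrt 5 := by ring
  rw [hl] at h
  refine h.congr' ?_
  filter_upwards [eventually_ge_atTop 2] with n hn
  have h2 : ((Zd.tubeCount 2 1 1 n : ℤ) : ℝ) = ((2 * zeil n : ℤ) : ℝ) := by rw [tubeCount_ladder_eq_fib n hn]
  push_cast at h2
  rw [h2]
  ring

end amplitude

end LadderZ

end Literature.Probability.RandomPlanarGeometry.SAW
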